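/-
Copyright (c) 2026 the pub-hodgecm-mathlib formalisation cell (harness21).  Prover seat hodgecm-mathlib-K2E4-p06 (g2), Track B ∕ K2-LIT (build stream 29),
h413 = `stmt-HodgeConjecture-24833`: road G of the junction ‹S_loc› from the CORRECTED germ-expansion letters (ii′)∕(iii′) on the ELLIPTIC G-regular filter.  2026-09-03.
-/
import Summits.HodgeConjecture.HodgeConjecture.Theorems.K2E3SingularTransferSignedOfLimitFormulas   -- ★ p855452 (this seat): frame-light imports + `constant_eq_of_eventually_expansions`, `eq_div_mul_of_mul_eq`, `div_neg_iff_right_of_neg`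
import HarnessLib

/-!
# h413 ∕ Track B «K2-LIT», ‹S› road G (corrected): ‹(ii′)› → ‹(iii′)› → ‹S_loc› on the ELLIPTIC G-regular filter (helper, `--supports`)

Cell `pub/hodgecm-mathlib`, crux H413 = `stmt-HodgeConjecture-24833`, route `HCCMUnconditional`; dealer-of-record K2E3-plan (g1) (U3b ED. 2 22c7786ce1ca1a0b hosts the ‹S›
local letters; this seat = line lead of (ii)).  THEOREMS ONLY (no `def`, no `instance`, no `notation`, no `sorry`, default heartbeats); count-neutral; hypotheses = the cand
bytes (ii′) `sig_K2E3SingularLimitFormulaHSideElliptic` and (iii′) `sig_K2E3SingularGermLimitGSideElliptic` (`K2/K2E4-p06/g2/…Elliptic.cand.K2E4-p06-g2.lean`, GREEN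
`:= by sorry`) VERBATIM; conclusion = ‹S_loc› `sig_K2E3SingularTransferSignedLocal` (U3b-g :306) VERBATIM, so ★ p855489 turns it into ‹S› and into U3b-b.

THE CORRECTION (this seat's self-audit 23:19Z).  The first-edition letters (ii) `sig_K2E3SingularLimitFormulaHSide` ∕ (iii) `sig_K2E3SingularGermLimitGSide` used the filter
`𝓝[G-regular] (γ_H)_v`, which contains the SPLIT-TORUS points near the centre; there the constant Shalika germ VANISHES (`Φ(a, f) = |D(a)|^{-1∕2}·∫_K∫_N f(k⁻¹ank)`, the
N-integral locally constant through `a = 1` — e.g. `Φ(a, 1_K) = |D(a)|^{-1∕2}` exactly), so «constant term = C·fH((γ_H)_v)» only holds on the ELLIPTIC G-regular set (print: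
Prop. 8.1.3 is stated for γ_H ELLIPTIC, p. 115), and (iii) was refutable by the witness `𝒢′ = {𝟙_ell} ∪ {Γ^st_u}`, `C_H = 0`.  The primed letters (ii′) ∕ (iii′) use
`𝓕_ell := 𝓝[{γ | IsLocalGRegular L v γ ∧ CompactSpace (Subgroup.centralizer {γ})}] (γ_H)_v` (the tree's ellipticity token, as in ★ `RankOneEulerPoincareNonsplit`) and a
non-split guard; every downstream byte (B_loc, (B), (D)^{ns}, ‹S_loc›, ‹S›) is unchanged.

* `singularTransferSignedLocal_of_ellipticGerms : ‹(ii′)› → ‹(iii′)› → ‹S_loc›` — (ii′) gives `𝒢`, `C_H < 0`, INDEP, the H-side expansions along `𝓕_ell`; (iii′) fed with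
  `𝒢` gives `C_G`, its sign law and the κ-side expansions along `𝓕_ell`; a transfer pair satisfies (4.3.1) at every G-regular `γ` (★ `isLocalDeltaTransfer_iff`), a fortiori
  `𝓕_ell`-eventually; ★ `constant_eq_of_eventually_expansions` equates the constants; `c := C_H ∕ C_G`.
[Rogawski1990 §8.1 Prop. 8.1.3 pp. 115–117, (8.1.1)–(8.1.2) p. 117; §8.2 Prop. 8.2.1 (a) p. 118; Kottwitz1988 §1 Prop. 1.]
HONEST LABEL: HC_CM is proved only modulo the 7 printed citations (2 remaining named inputs: hLiu418 = stmt-HodgeConjecture-24832, h413 = stmt-HodgeConjecture-24833) until rung 0 closes; implication only — (ii′), (iii′) are E3's letters to pay.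

## References
* [Rogawski1990] J. D. Rogawski, *Automorphic Representations of Unitary Groups in Three Variables*, Ann. of Math. Stud. 123 (1990): §8.1 Props. 8.1.1–8.1.4 pp. 112–117;
  §8.2 Prop. 8.2.1 (a) pp. 117–118; §4.3 (4.3.1) p. 43.
* [Kottwitz1988] R. E. Kottwitz, *Tamagawa numbers*, Ann. of Math. 127 (1988), §1 Prop. 1.
-/

set_option autoImplicit false
set_option linter.dupNamespace false

noncomputable section

open Filter Topology
open MeasureTheory Measure NumberField IsDedekindDomain
open Literature.MeasureTheory.Group Literature.MeasureTheory.RestrictedProduct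
open Literature.Topology.RestrictedProduct Literature.Topology.Algebra.RestrictedProduct
open Literature.NumberTheory.Rogawski1990 Literature.NumberTheory.Automorphic
open Literature.AlgebraicGeometry.ShimuraVarieties (unitaryGroup hermForm)
open scoped Matrix MatrixGroups RestrictedProduct

namespace Summit.HodgeConjecture.HodgeConjecture.Cruxes.H413.K2E3SingularTransferSignedLocalOfEllipticGerms

open Summit.HodgeConjecture.HodgeConjecture.Cruxes.H413.K2E3SingularTransferSignedOfLimitFormulas
  (constant_eq_of_eventually_expansions eq_div_mul_of_mul_eq div_neg_iff_right_of_neg)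

/-- **‹S_loc› FROM (ii′) AND (iii′)** (hypotheses = the two corrected cand bytes; conclusion = U3b-g `sig_K2E3SingularTransferSignedLocal` VERBATIM).  The transfer identity at every
G-regular point holds in particular along the elliptic filter `𝓕_ell`; the two expansions there have the same tails family, so ★ `constant_eq_of_eventually_expansions` gives
`C_H·fH((γ_H)_v) = C_G·Δ‴_v·Φ^st_{|ω|}`; `c := C_H ∕ C_G` is real, non-zero, and negative iff `0 < C_G` iff the `e₁`-eigenplane is anisotropic.
[cite: Rogawski1990, §8.1 Prop. 8.1.3 pp. 115–117, (8.1.1)–(8.1.2) p. 117; §8.2 Prop. 8.2.1 (a) p. 118] [cite: Kottwitz1988, §1 Prop. 1] -/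
theorem singularTransferSignedLocal_of_ellipticGerms
    (hII :
    ∀ (L : Type) [Field L] [NumberField L] [IsCMField L] (H' : Matrix (Fin 3) (Fin 3) L),
      (H'.map (cmConjRingHom L)).transpose = H' →
      (∀ x : Fin 3 → L, hermForm (cmConjRingHom L) H' x x = 0 → x = 0) →
    ∀ (v : HeightOneSpectrum (𝓞 ↥(maximalRealSubfield L)))
      [MeasurableSpace ((UnitaryGroup.cmDatum L 2 (Matrix.of fun i j : Fin 2 => if i.val + j.val + 1 = 2 then (1 : L) else 0)).Local v × (UnitaryGroup.cmDatum L 1 (Matrix.of fun i j : Fin 1 => if i.val + j.val + 1 = 1 then (1 : L) else 0)).Local v)] [BorelSpace ((UnitaryGroup.cmDatum L 2 (Matrix.of fun i j : Fin 2 => if i.val + j.val + 1 = 2 then (1 : L) else 0)).Local v × (UnitaryGroup.cmDatum L 1 (Matrix.of fun i j : Fin 1 => if i.val + j.val + 1 = 1 then (1 : L) else 0)).Local v)]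
      [∀ a : (UnitaryGroup.cmDatum L 2 (Matrix.of fun i j : Fin 2 => if i.val + j.val + 1 = 2 then (1 : L) else 0)).Local v × (UnitaryGroup.cmDatum L 1 (Matrix.of fun i j : Fin 1 => if i.val + j.val + 1 = 1 then (1 : L) else 0)).Local v,
        MeasurableSpace (((UnitaryGroup.cmDatum L 2 (Matrix.of fun i j : Fin 2 => if i.val + j.val + 1 = 2 then (1 : L) else 0)).Local v × (UnitaryGroup.cmDatum L 1 (Matrix.of fun i j : Fin 1 => if i.val + j.val + 1 = 1 then (1 : L) else 0)).Local v) ⧸ Subgroup.centralizer ({a} : Set ((UnitaryGroup.cmDatum L 2 (Matrix.of fun i j : Fin 2 => if i.val + j.val + 1 = 2 then (1 : L) else 0)).Local v × (UnitaryGroup.cmDatum L 1 (Matrix.of fun i j : Fin 1 => if i.val + j.val + 1 = 1 then (1 : L) else 0)).Local v)))]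
      [∀ a : (UnitaryGroup.cmDatum L 2 (Matrix.of fun i j : Fin 2 => if i.val + j.val + 1 = 2 then (1 : L) else 0)).Local v × (UnitaryGroup.cmDatum L 1 (Matrix.of fun i j : Fin 1 => if i.val + j.val + 1 = 1 then (1 : L) else 0)).Local v,
        BorelSpace (((UnitaryGroup.cmDatum L 2 (Matrix.of fun i j : Fin 2 => if i.val + j.val + 1 = 2 then (1 : L) else 0)).Local v × (UnitaryGroup.cmDatum L 1 (Matrix.of fun i j : Fin 1 => if i.val + j.val + 1 = 1 then (1 : L) else 0)).Local v) ⧸ Subgroup.centralizer ({a} : Set ((UnitaryGroup.cmDatum L 2 (Matrix.of fun i j : Fin 2 => if i.val + j.val + 1 = 2 then (1 : L) else 0)).Local v × (UnitaryGroup.cmDatum L 1 (Matrix.of fun i j : Fin 1 => if i.val + j.val + 1 = 1 then (1 : L) else 0)).Local v)))]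
      [MeasurableSpace ((UnitaryGroup.cmDatum L 3 H').Local v)] [BorelSpace ((UnitaryGroup.cmDatum L 3 H').Local v)]
      [∀ γ : (UnitaryGroup.cmDatum L 3 H').Local v, MeasurableSpace ((UnitaryGroup.cmDatum L 3 H').Local v ⧸ Subgroup.centralizer ({γ} : Set ((UnitaryGroup.cmDatum L 3 H').Local v)))]
      [∀ γ : (UnitaryGroup.cmDatum L 3 H').Local v, BorelSpace ((UnitaryGroup.cmDatum L 3 H').Local v ⧸ Subgroup.centralizer ({γ} : Set ((UnitaryGroup.cmDatum L 3 H').Local v)))]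
      (νHv : Measure ((UnitaryGroup.cmDatum L 2 (Matrix.of fun i j : Fin 2 => if i.val + j.val + 1 = 2 then (1 : L) else 0)).Local v × (UnitaryGroup.cmDatum L 1 (Matrix.of fun i j : Fin 1 => if i.val + j.val + 1 = 1 then (1 : L) else 0)).Local v)) (νGv : Measure ((UnitaryGroup.cmDatum L 3 H').Local v))
      [IsFiniteMeasureOnCompacts νHv] [νHv.IsMulRightInvariant] [νGv.IsHaarMeasure] [νGv.IsMulRightInvariant]
      (Δv : LocalTransferFactor L H' v)
      (mHv : OrbitalMeasureFamily ((UnitaryGroup.cmDatum L 2 (Matrix.of fun i j : Fin 2 => if i.val + j.val + 1 = 2 then (1 : L) else 0)).Local v × (UnitaryGroup.cmDatum L 1 (Matrix.of fun i j : Fin 1 => if i.val + j.val + 1 = 1 then (1 : L) else 0)).Local v)) (mGv : OrbitalMeasureFamily ((UnitaryGroup.cmDatum L 3 H').Local v)),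
      IsLocalTransferDatum L H' v Δv mHv mGv →
      mHv.IsCanonical (IsLocalGRegular L v) νHv →
      mGv.IsCanonical (fun γ : (UnitaryGroup.cmDatum L 3 H').Local v => IsRegularElt (γ.val : GL (Fin 3) (UnitaryGroup.LocalRing L v))) νGv →
      Subsingleton (UnitaryGroup.PlacesOver L v) →
    ∀ (γH : (UnitaryGroup.cmDatum L 2 (Matrix.of fun i j : Fin 2 => if i.val + j.val + 1 = 2 then (1 : L) else 0)).Rational × (UnitaryGroup.cmDatum L 1 (Matrix.of fun i j : Fin 1 => if i.val + j.val + 1 = 1 then (1 : L) else 0)).Rational) (e₁ : L),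
      (((γH.1 : unitaryGroup (cmConjRingHom L) (Matrix.of fun i j : Fin 2 => if i.val + j.val + 1 = 2 then (1 : L) else 0)).val : GL (Fin 2) L) : Matrix (Fin 2) (Fin 2) L) =
        e₁ • (1 : Matrix (Fin 2) (Fin 2) L) →
    ∃ (𝒢 : Finset ((UnitaryGroup.cmDatum L 2 (Matrix.of fun i j : Fin 2 => if i.val + j.val + 1 = 2 then (1 : L) else 0)).Local v × (UnitaryGroup.cmDatum L 1 (Matrix.of fun i j : Fin 1 => if i.val + j.val + 1 = 1 then (1 : L) else 0)).Local v → ℂ)) (C_H : ℝ), C_H < 0 ∧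
      (∀ (c₀ : ℂ) (a : ((UnitaryGroup.cmDatum L 2 (Matrix.of fun i j : Fin 2 => if i.val + j.val + 1 = 2 then (1 : L) else 0)).Local v × (UnitaryGroup.cmDatum L 1 (Matrix.of fun i j : Fin 1 => if i.val + j.val + 1 = 1 then (1 : L) else 0)).Local v → ℂ) → ℂ),
        (∀ᶠ γ in 𝓝[{γ : (UnitaryGroup.cmDatum L 2 (Matrix.of fun i j : Fin 2 => if i.val + j.val + 1 = 2 then (1 : L) else 0)).Local v × (UnitaryGroup.cmDatum L 1 (Matrix.of fun i j : Fin 1 => if i.val + j.val + 1 = 1 then (1 : L) else 0)).Local v |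
            IsLocalGRegular L v γ ∧ CompactSpace (Subgroup.centralizer ({γ} : Set ((UnitaryGroup.cmDatum L 2 (Matrix.of fun i j : Fin 2 => if i.val + j.val + 1 = 2 then (1 : L) else 0)).Local v × (UnitaryGroup.cmDatum L 1 (Matrix.of fun i j : Fin 1 => if i.val + j.val + 1 = 1 then (1 : L) else 0)).Local v)))}]
          ((UnitaryGroup.cmDatum L 2 (Matrix.of fun i j : Fin 2 => if i.val + j.val + 1 = 2 then (1 : L) else 0)).toLocal v ((UnitaryGroup.cmDatum L 2 (Matrix.of fun i j : Fin 2 => if i.val + j.val + 1 = 2 then (1 : L) else 0)).toAdelic γH.1),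
            (UnitaryGroup.cmDatum L 1 (Matrix.of fun i j : Fin 1 => if i.val + j.val + 1 = 1 then (1 : L) else 0)).toLocal v ((UnitaryGroup.cmDatum L 1 (Matrix.of fun i j : Fin 1 => if i.val + j.val + 1 = 1 then (1 : L) else 0)).toAdelic γH.2)),
          c₀ + ∑ g ∈ 𝒢, a g * g γ = 0) → c₀ = 0) ∧
      (∀ fH : (UnitaryGroup.cmDatum L 2 (Matrix.of fun i j : Fin 2 => if i.val + j.val + 1 = 2 then (1 : L) else 0)).Local v × (UnitaryGroup.cmDatum L 1 (Matrix.of fun i j : Fin 1 => if i.val + j.val + 1 = 1 then (1 : L) else 0)).Local v → ℂ, IsLocSmooth fH →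
        ∃ a : ((UnitaryGroup.cmDatum L 2 (Matrix.of fun i j : Fin 2 => if i.val + j.val + 1 = 2 then (1 : L) else 0)).Local v × (UnitaryGroup.cmDatum L 1 (Matrix.of fun i j : Fin 1 => if i.val + j.val + 1 = 1 then (1 : L) else 0)).Local v → ℂ) → ℂ, ∀ᶠ γ in 𝓝[{γ : (UnitaryGroup.cmDatum L 2 (Matrix.of fun i j : Fin 2 => if i.val + j.val + 1 = 2 then (1 : L) else 0)).Local v × (UnitaryGroup.cmDatum L 1 (Matrix.of fun i j : Fin 1 => if i.val + j.val + 1 = 1 then (1 : L) else 0)).Local v |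
            IsLocalGRegular L v γ ∧ CompactSpace (Subgroup.centralizer ({γ} : Set ((UnitaryGroup.cmDatum L 2 (Matrix.of fun i j : Fin 2 => if i.val + j.val + 1 = 2 then (1 : L) else 0)).Local v × (UnitaryGroup.cmDatum L 1 (Matrix.of fun i j : Fin 1 => if i.val + j.val + 1 = 1 then (1 : L) else 0)).Local v)))}]
          ((UnitaryGroup.cmDatum L 2 (Matrix.of fun i j : Fin 2 => if i.val + j.val + 1 = 2 then (1 : L) else 0)).toLocal v ((UnitaryGroup.cmDatum L 2 (Matrix.of fun i j : Fin 2 => if i.val + j.val + 1 = 2 then (1 : L) else 0)).toAdelic γH.1),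
            (UnitaryGroup.cmDatum L 1 (Matrix.of fun i j : Fin 1 => if i.val + j.val + 1 = 1 then (1 : L) else 0)).toLocal v ((UnitaryGroup.cmDatum L 1 (Matrix.of fun i j : Fin 1 => if i.val + j.val + 1 = 1 then (1 : L) else 0)).toAdelic γH.2)),
          stableOrbitalIntegralRel (IsLocalStablyConjH L v) mHv fH γ =
            (C_H : ℂ) * fH ((UnitaryGroup.cmDatum L 2 (Matrix.of fun i j : Fin 2 => if i.val + j.val + 1 = 2 then (1 : L) else 0)).toLocal v ((UnitaryGroup.cmDatum L 2 (Matrix.of fun i j : Fin 2 => if i.val + j.val + 1 = 2 then (1 : L) else 0)).toAdelic γH.1),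
            (UnitaryGroup.cmDatum L 1 (Matrix.of fun i j : Fin 1 => if i.val + j.val + 1 = 1 then (1 : L) else 0)).toLocal v ((UnitaryGroup.cmDatum L 1 (Matrix.of fun i j : Fin 1 => if i.val + j.val + 1 = 1 then (1 : L) else 0)).toAdelic γH.2)) + ∑ g ∈ 𝒢, a g * g γ))
    (hIII :
    ∀ (L : Type) [Field L] [NumberField L] [IsCMField L] (H' : Matrix (Fin 3) (Fin 3) L),
      (H'.map (cmConjRingHom L)).transpose = H' →
      (∀ x : Fin 3 → L, hermForm (cmConjRingHom L) H' x x = 0 → x = 0) →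
    ∀ (v : HeightOneSpectrum (𝓞 ↥(maximalRealSubfield L)))
      [MeasurableSpace ((UnitaryGroup.cmDatum L 2 (Matrix.of fun i j : Fin 2 => if i.val + j.val + 1 = 2 then (1 : L) else 0)).Local v × (UnitaryGroup.cmDatum L 1 (Matrix.of fun i j : Fin 1 => if i.val + j.val + 1 = 1 then (1 : L) else 0)).Local v)] [BorelSpace ((UnitaryGroup.cmDatum L 2 (Matrix.of fun i j : Fin 2 => if i.val + j.val + 1 = 2 then (1 : L) else 0)).Local v × (UnitaryGroup.cmDatum L 1 (Matrix.of fun i j : Fin 1 => if i.val + j.val + 1 = 1 then (1 : L) else 0)).Local v)]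
      [∀ a : (UnitaryGroup.cmDatum L 2 (Matrix.of fun i j : Fin 2 => if i.val + j.val + 1 = 2 then (1 : L) else 0)).Local v × (UnitaryGroup.cmDatum L 1 (Matrix.of fun i j : Fin 1 => if i.val + j.val + 1 = 1 then (1 : L) else 0)).Local v,
        MeasurableSpace (((UnitaryGroup.cmDatum L 2 (Matrix.of fun i j : Fin 2 => if i.val + j.val + 1 = 2 then (1 : L) else 0)).Local v × (UnitaryGroup.cmDatum L 1 (Matrix.of fun i j : Fin 1 => if i.val + j.val + 1 = 1 then (1 : L) else 0)).Local v) ⧸ Subgroup.centralizer ({a} : Set ((UnitaryGroup.cmDatum L 2 (Matrix.of fun i j : Fin 2 => if i.val + j.val + 1 = 2 then (1 : L) else 0)).Local v × (UnitaryGroup.cmDatum L 1 (Matrix.of fun i j : Fin 1 => if i.val + j.val + 1 = 1 then (1 : L) else 0)).Local v)))]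
      [∀ a : (UnitaryGroup.cmDatum L 2 (Matrix.of fun i j : Fin 2 => if i.val + j.val + 1 = 2 then (1 : L) else 0)).Local v × (UnitaryGroup.cmDatum L 1 (Matrix.of fun i j : Fin 1 => if i.val + j.val + 1 = 1 then (1 : L) else 0)).Local v,
        BorelSpace (((UnitaryGroup.cmDatum L 2 (Matrix.of fun i j : Fin 2 => if i.val + j.val + 1 = 2 then (1 : L) else 0)).Local v × (UnitaryGroup.cmDatum L 1 (Matrix.of fun i j : Fin 1 => if i.val + j.val + 1 = 1 then (1 : L) else 0)).Local v) ⧸ Subgroup.centralizer ({a} : Set ((UnitaryGroup.cmDatum L 2 (Matrix.of fun i j : Fin 2 => if i.val + j.val + 1 = 2 then (1 : L) else 0)).Local v × (UnitaryGroup.cmDatum L 1 (Matrix.of fun i j : Fin 1 => if i.val + j.val + 1 = 1 then (1 : L) else 0)).Local v)))]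
      [MeasurableSpace ((UnitaryGroup.cmDatum L 3 H').Local v)] [BorelSpace ((UnitaryGroup.cmDatum L 3 H').Local v)]
      [∀ γ : (UnitaryGroup.cmDatum L 3 H').Local v, MeasurableSpace ((UnitaryGroup.cmDatum L 3 H').Local v ⧸ Subgroup.centralizer ({γ} : Set ((UnitaryGroup.cmDatum L 3 H').Local v)))]
      [∀ γ : (UnitaryGroup.cmDatum L 3 H').Local v, BorelSpace ((UnitaryGroup.cmDatum L 3 H').Local v ⧸ Subgroup.centralizer ({γ} : Set ((UnitaryGroup.cmDatum L 3 H').Local v)))]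
      (νHv : Measure ((UnitaryGroup.cmDatum L 2 (Matrix.of fun i j : Fin 2 => if i.val + j.val + 1 = 2 then (1 : L) else 0)).Local v × (UnitaryGroup.cmDatum L 1 (Matrix.of fun i j : Fin 1 => if i.val + j.val + 1 = 1 then (1 : L) else 0)).Local v)) (νGv : Measure ((UnitaryGroup.cmDatum L 3 H').Local v))
      [IsFiniteMeasureOnCompacts νHv] [νHv.IsMulRightInvariant] [νGv.IsHaarMeasure] [νGv.IsMulRightInvariant]
      (Δv : LocalTransferFactor L H' v)
      (mHv : OrbitalMeasureFamily ((UnitaryGroup.cmDatum L 2 (Matrix.of fun i j : Fin 2 => if i.val + j.val + 1 = 2 then (1 : L) else 0)).Local v × (UnitaryGroup.cmDatum L 1 (Matrix.of fun i j : Fin 1 => if i.val + j.val + 1 = 1 then (1 : L) else 0)).Local v)) (mGv : OrbitalMeasureFamily ((UnitaryGroup.cmDatum L 3 H').Local v)),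
      IsLocalTransferDatum L H' v Δv mHv mGv →
      mHv.IsCanonical (IsLocalGRegular L v) νHv →
      mGv.IsCanonical (fun γ : (UnitaryGroup.cmDatum L 3 H').Local v => IsRegularElt (γ.val : GL (Fin 3) (UnitaryGroup.LocalRing L v))) νGv →
      Subsingleton (UnitaryGroup.PlacesOver L v) →
    ∀ (μ : Literature.NumberTheory.GaloisRepresentations.HeckeCharacter L), μ.IsUnitary →
      (∀ x : Literature.NumberTheory.GaloisRepresentations.ideleGroup ↥(maximalRealSubfield L),
        μ (AdeleRing.ideleBaseChange (↥(maximalRealSubfield L)) L x) = quadraticHeckeCharCM L x) →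
      Δv = finExplicitCollection L H' μ (finExplicitDelta_conj_left_all L H' μ) (finExplicitDelta_conj_right_all L H' μ) v →
    ∀ (mGs₀v : OrbitalMeasureFamily ((UnitaryGroup.cmDatum L 3 H').Local v)),
      mGs₀v.IsQuotientOf (fun x : (UnitaryGroup.cmDatum L 3 H').Local v => ∃ γ₀ : (UnitaryGroup.cmDatum L 3 H').Rational, ¬ IsRegularElt (γ₀.val : GL (Fin 3) L) ∧
          Corresponds (UnitaryGroup.conjLocal L (IsCMField.complexConj L) v)
            ((UnitaryGroup.adelicForm L 3 H').map (UnitaryGroup.adeleToLocal L v))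
            ((UnitaryGroup.adelicForm L 3 H').map (UnitaryGroup.adeleToLocal L v))
            ((UnitaryGroup.cmDatum L 3 H').toLocal v ((UnitaryGroup.cmDatum L 3 H').toAdelic γ₀)) x) νGv (Literature.NumberTheory.Weil1982.UnitaryFinTopForm.finTamagawaPartner L 3 H' v) →
    ∀ (γ₀ : (UnitaryGroup.cmDatum L 3 H').Rational) (e₁ e₂ : L), e₁ ≠ e₂ →
      ((((γ₀ : unitaryGroup (cmConjRingHom L) H').val : GL (Fin 3) L) : Matrix (Fin 3) (Fin 3) L) - e₁ • (1 : Matrix (Fin 3) (Fin 3) L)) *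
        ((((γ₀ : unitaryGroup (cmConjRingHom L) H').val : GL (Fin 3) L) : Matrix (Fin 3) (Fin 3) L) - e₂ • (1 : Matrix (Fin 3) (Fin 3) L)) = 0 →
      (¬ ∃ ζ : L, (((γ₀ : unitaryGroup (cmConjRingHom L) H').val : GL (Fin 3) L) : Matrix (Fin 3) (Fin 3) L) = ζ • (1 : Matrix (Fin 3) (Fin 3) L)) →
      (((γ₀ : unitaryGroup (cmConjRingHom L) H').val : GL (Fin 3) L) : Matrix (Fin 3) (Fin 3) L).charpoly =
        (Polynomial.X - Polynomial.C e₁) ^ 2 * (Polynomial.X - Polynomial.C e₂) →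
    ∀ (γH : (UnitaryGroup.cmDatum L 2 (Matrix.of fun i j : Fin 2 => if i.val + j.val + 1 = 2 then (1 : L) else 0)).Rational × (UnitaryGroup.cmDatum L 1 (Matrix.of fun i j : Fin 1 => if i.val + j.val + 1 = 1 then (1 : L) else 0)).Rational),
      (((γH.1 : unitaryGroup (cmConjRingHom L) (Matrix.of fun i j : Fin 2 => if i.val + j.val + 1 = 2 then (1 : L) else 0)).val : GL (Fin 2) L) : Matrix (Fin 2) (Fin 2) L) =
        e₁ • (1 : Matrix (Fin 2) (Fin 2) L) →
      (((γH.2 : unitaryGroup (cmConjRingHom L) (Matrix.of fun i j : Fin 1 => if i.val + j.val + 1 = 1 then (1 : L) else 0)).val : GL (Fin 1) L) : Matrix (Fin 1) (Fin 1) L) 0 0 = e₂ →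
    ∀ (𝒢 : Finset ((UnitaryGroup.cmDatum L 2 (Matrix.of fun i j : Fin 2 => if i.val + j.val + 1 = 2 then (1 : L) else 0)).Local v × (UnitaryGroup.cmDatum L 1 (Matrix.of fun i j : Fin 1 => if i.val + j.val + 1 = 1 then (1 : L) else 0)).Local v → ℂ)) (C_H : ℝ),
      (∀ (c₀ : ℂ) (a : ((UnitaryGroup.cmDatum L 2 (Matrix.of fun i j : Fin 2 => if i.val + j.val + 1 = 2 then (1 : L) else 0)).Local v × (UnitaryGroup.cmDatum L 1 (Matrix.of fun i j : Fin 1 => if i.val + j.val + 1 = 1 then (1 : L) else 0)).Local v → ℂ) → ℂ),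
        (∀ᶠ γ in 𝓝[{γ : (UnitaryGroup.cmDatum L 2 (Matrix.of fun i j : Fin 2 => if i.val + j.val + 1 = 2 then (1 : L) else 0)).Local v × (UnitaryGroup.cmDatum L 1 (Matrix.of fun i j : Fin 1 => if i.val + j.val + 1 = 1 then (1 : L) else 0)).Local v |
            IsLocalGRegular L v γ ∧ CompactSpace (Subgroup.centralizer ({γ} : Set ((UnitaryGroup.cmDatum L 2 (Matrix.of fun i j : Fin 2 => if i.val + j.val + 1 = 2 then (1 : L) else 0)).Local v × (UnitaryGroup.cmDatum L 1 (Matrix.of fun i j : Fin 1 => if i.val + j.val + 1 = 1 then (1 : L) else 0)).Local v)))}]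
          ((UnitaryGroup.cmDatum L 2 (Matrix.of fun i j : Fin 2 => if i.val + j.val + 1 = 2 then (1 : L) else 0)).toLocal v ((UnitaryGroup.cmDatum L 2 (Matrix.of fun i j : Fin 2 => if i.val + j.val + 1 = 2 then (1 : L) else 0)).toAdelic γH.1),
            (UnitaryGroup.cmDatum L 1 (Matrix.of fun i j : Fin 1 => if i.val + j.val + 1 = 1 then (1 : L) else 0)).toLocal v ((UnitaryGroup.cmDatum L 1 (Matrix.of fun i j : Fin 1 => if i.val + j.val + 1 = 1 then (1 : L) else 0)).toAdelic γH.2)),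
          c₀ + ∑ g ∈ 𝒢, a g * g γ = 0) → c₀ = 0) →
      (∀ fH : (UnitaryGroup.cmDatum L 2 (Matrix.of fun i j : Fin 2 => if i.val + j.val + 1 = 2 then (1 : L) else 0)).Local v × (UnitaryGroup.cmDatum L 1 (Matrix.of fun i j : Fin 1 => if i.val + j.val + 1 = 1 then (1 : L) else 0)).Local v → ℂ, IsLocSmooth fH →
        ∃ a : ((UnitaryGroup.cmDatum L 2 (Matrix.of fun i j : Fin 2 => if i.val + j.val + 1 = 2 then (1 : L) else 0)).Local v × (UnitaryGroup.cmDatum L 1 (Matrix.of fun i j : Fin 1 => if i.val + j.val + 1 = 1 then (1 : L) else 0)).Local v → ℂ) → ℂ, ∀ᶠ γ in 𝓝[{γ : (UnitaryGroup.cmDatum L 2 (Matrix.of fun i j : Fin 2 => if i.val + j.val + 1 = 2 then (1 : L) else 0)).Local v × (UnitaryGroup.cmDatum L 1 (Matrix.of fun i j : Fin 1 => if i.val + j.val + 1 = 1 then (1 : L) else 0)).Local v |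
            IsLocalGRegular L v γ ∧ CompactSpace (Subgroup.centralizer ({γ} : Set ((UnitaryGroup.cmDatum L 2 (Matrix.of fun i j : Fin 2 => if i.val + j.val + 1 = 2 then (1 : L) else 0)).Local v × (UnitaryGroup.cmDatum L 1 (Matrix.of fun i j : Fin 1 => if i.val + j.val + 1 = 1 then (1 : L) else 0)).Local v)))}]
          ((UnitaryGroup.cmDatum L 2 (Matrix.of fun i j : Fin 2 => if i.val + j.val + 1 = 2 then (1 : L) else 0)).toLocal v ((UnitaryGroup.cmDatum L 2 (Matrix.of fun i j : Fin 2 => if i.val + j.val + 1 = 2 then (1 : L) else 0)).toAdelic γH.1),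
            (UnitaryGroup.cmDatum L 1 (Matrix.of fun i j : Fin 1 => if i.val + j.val + 1 = 1 then (1 : L) else 0)).toLocal v ((UnitaryGroup.cmDatum L 1 (Matrix.of fun i j : Fin 1 => if i.val + j.val + 1 = 1 then (1 : L) else 0)).toAdelic γH.2)),
          stableOrbitalIntegralRel (IsLocalStablyConjH L v) mHv fH γ =
            (C_H : ℂ) * fH ((UnitaryGroup.cmDatum L 2 (Matrix.of fun i j : Fin 2 => if i.val + j.val + 1 = 2 then (1 : L) else 0)).toLocal v ((UnitaryGroup.cmDatum L 2 (Matrix.of fun i j : Fin 2 => if i.val + j.val + 1 = 2 then (1 : L) else 0)).toAdelic γH.1),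
            (UnitaryGroup.cmDatum L 1 (Matrix.of fun i j : Fin 1 => if i.val + j.val + 1 = 1 then (1 : L) else 0)).toLocal v ((UnitaryGroup.cmDatum L 1 (Matrix.of fun i j : Fin 1 => if i.val + j.val + 1 = 1 then (1 : L) else 0)).toAdelic γH.2)) + ∑ g ∈ 𝒢, a g * g γ) →
    ∃ C_G : ℝ, C_G ≠ 0 ∧ (0 < C_G ↔ (∀ x : Fin 3 → UnitaryGroup.LocalRing L v,
            Matrix.mulVec (((((γ₀ : unitaryGroup (cmConjRingHom L) H').val : GL (Fin 3) L) : Matrix (Fin 3) (Fin 3) L)).map (algebraMap L (UnitaryGroup.LocalRing L v)) -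
                algebraMap L (UnitaryGroup.LocalRing L v) e₁ • (1 : Matrix (Fin 3) (Fin 3) (UnitaryGroup.LocalRing L v))) x = 0 →
            (∑ i, ∑ j, UnitaryGroup.conjLocal L (IsCMField.complexConj L) v (x i) * algebraMap L (UnitaryGroup.LocalRing L v) (H' i j) * x j) = 0 →
            x = 0)) ∧
      ∀ f : (UnitaryGroup.cmDatum L 3 H').Local v → ℂ, IsLocSmooth f →
        ∃ b : ((UnitaryGroup.cmDatum L 2 (Matrix.of fun i j : Fin 2 => if i.val + j.val + 1 = 2 then (1 : L) else 0)).Local v × (UnitaryGroup.cmDatum L 1 (Matrix.of fun i j : Fin 1 => if i.val + j.val + 1 = 1 then (1 : L) else 0)).Local v → ℂ) → ℂ, ∀ᶠ γ in 𝓝[{γ : (UnitaryGroup.cmDatum L 2 (Matrix.of fun i j : Fin 2 => if i.val + j.val + 1 = 2 then (1 : L) else 0)).Local v × (UnitaryGroup.cmDatum L 1 (Matrix.of fun i j : Fin 1 => if i.val + j.val + 1 = 1 then (1 : L) else 0)).Local v |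
            IsLocalGRegular L v γ ∧ CompactSpace (Subgroup.centralizer ({γ} : Set ((UnitaryGroup.cmDatum L 2 (Matrix.of fun i j : Fin 2 => if i.val + j.val + 1 = 2 then (1 : L) else 0)).Local v × (UnitaryGroup.cmDatum L 1 (Matrix.of fun i j : Fin 1 => if i.val + j.val + 1 = 1 then (1 : L) else 0)).Local v)))}]
          ((UnitaryGroup.cmDatum L 2 (Matrix.of fun i j : Fin 2 => if i.val + j.val + 1 = 2 then (1 : L) else 0)).toLocal v ((UnitaryGroup.cmDatum L 2 (Matrix.of fun i j : Fin 2 => if i.val + j.val + 1 = 2 then (1 : L) else 0)).toAdelic γH.1),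
            (UnitaryGroup.cmDatum L 1 (Matrix.of fun i j : Fin 1 => if i.val + j.val + 1 = 1 then (1 : L) else 0)).toLocal v ((UnitaryGroup.cmDatum L 1 (Matrix.of fun i j : Fin 1 => if i.val + j.val + 1 = 1 then (1 : L) else 0)).toAdelic γH.2)),
          (∑ᶠ c : ConjClasses ((UnitaryGroup.cmDatum L 3 H').Local v), Δv.Δ γ (Quotient.out c) * classOrbitalIntegral mGv f c) =
            (C_G : ℂ) * (Δv.Δ ((UnitaryGroup.cmDatum L 2 (Matrix.of fun i j : Fin 2 => if i.val + j.val + 1 = 2 then (1 : L) else 0)).toLocal v ((UnitaryGroup.cmDatum L 2 (Matrix.of fun i j : Fin 2 => if i.val + j.val + 1 = 2 then (1 : L) else 0)).toAdelic γH.1),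
            (UnitaryGroup.cmDatum L 1 (Matrix.of fun i j : Fin 1 => if i.val + j.val + 1 = 1 then (1 : L) else 0)).toLocal v ((UnitaryGroup.cmDatum L 1 (Matrix.of fun i j : Fin 1 => if i.val + j.val + 1 = 1 then (1 : L) else 0)).toAdelic γH.2)) ((UnitaryGroup.cmDatum L 3 H').toLocal v ((UnitaryGroup.cmDatum L 3 H').toAdelic γ₀)) *
              localStableOrbitalIntegral L 3 H' v mGs₀v f ((UnitaryGroup.cmDatum L 3 H').toLocal v ((UnitaryGroup.cmDatum L 3 H').toAdelic γ₀))) + ∑ g ∈ 𝒢, b g * g γ) :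
    ∀ (L : Type) [Field L] [NumberField L] [IsCMField L] (H' : Matrix (Fin 3) (Fin 3) L),
      (H'.map (cmConjRingHom L)).transpose = H' →
      (∀ x : Fin 3 → L, hermForm (cmConjRingHom L) H' x x = 0 → x = 0) →
    ∀ (v : HeightOneSpectrum (𝓞 ↥(maximalRealSubfield L)))
      [MeasurableSpace ((UnitaryGroup.cmDatum L 2 (Matrix.of fun i j : Fin 2 => if i.val + j.val + 1 = 2 then (1 : L) else 0)).Local v × (UnitaryGroup.cmDatum L 1 (Matrix.of fun i j : Fin 1 => if i.val + j.val + 1 = 1 then (1 : L) else 0)).Local v)] [BorelSpace ((UnitaryGroup.cmDatum L 2 (Matrix.of fun i j : Fin 2 => if i.val + j.val + 1 = 2 then (1 : L) else 0)).Local v × (UnitaryGroup.cmDatum L 1 (Matrix.of fun i j : Fin 1 => if i.val + j.val + 1 = 1 then (1 : L) else 0)).Local v)]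
      [∀ a : (UnitaryGroup.cmDatum L 2 (Matrix.of fun i j : Fin 2 => if i.val + j.val + 1 = 2 then (1 : L) else 0)).Local v × (UnitaryGroup.cmDatum L 1 (Matrix.of fun i j : Fin 1 => if i.val + j.val + 1 = 1 then (1 : L) else 0)).Local v,
        MeasurableSpace (((UnitaryGroup.cmDatum L 2 (Matrix.of fun i j : Fin 2 => if i.val + j.val + 1 = 2 then (1 : L) else 0)).Local v × (UnitaryGroup.cmDatum L 1 (Matrix.of fun i j : Fin 1 => if i.val + j.val + 1 = 1 then (1 : L) else 0)).Local v) ⧸ Subgroup.centralizer ({a} : Set ((UnitaryGroup.cmDatum L 2 (Matrix.of fun i j : Fin 2 => if i.val + j.val + 1 = 2 then (1 : L) else 0)).Local v × (UnitaryGroup.cmDatum L 1 (Matrix.of fun i j : Fin 1 => if i.val + j.val + 1 = 1 then (1 : L) else 0)).Local v)))]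
      [∀ a : (UnitaryGroup.cmDatum L 2 (Matrix.of fun i j : Fin 2 => if i.val + j.val + 1 = 2 then (1 : L) else 0)).Local v × (UnitaryGroup.cmDatum L 1 (Matrix.of fun i j : Fin 1 => if i.val + j.val + 1 = 1 then (1 : L) else 0)).Local v,
        BorelSpace (((UnitaryGroup.cmDatum L 2 (Matrix.of fun i j : Fin 2 => if i.val + j.val + 1 = 2 then (1 : L) else 0)).Local v × (UnitaryGroup.cmDatum L 1 (Matrix.of fun i j : Fin 1 => if i.val + j.val + 1 = 1 then (1 : L) else 0)).Local v) ⧸ Subgroup.centralizer ({a} : Set ((UnitaryGroup.cmDatum L 2 (Matrix.of fun i j : Fin 2 => if i.val + j.val + 1 = 2 then (1 : L) else 0)).Local v × (UnitaryGroup.cmDatum L 1 (Matrix.of fun i j : Fin 1 => if i.val + j.val + 1 = 1 then (1 : L) else 0)).Local v)))]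
      [MeasurableSpace ((UnitaryGroup.cmDatum L 3 H').Local v)] [BorelSpace ((UnitaryGroup.cmDatum L 3 H').Local v)]
      [∀ γ : (UnitaryGroup.cmDatum L 3 H').Local v, MeasurableSpace ((UnitaryGroup.cmDatum L 3 H').Local v ⧸ Subgroup.centralizer ({γ} : Set ((UnitaryGroup.cmDatum L 3 H').Local v)))]
      [∀ γ : (UnitaryGroup.cmDatum L 3 H').Local v, BorelSpace ((UnitaryGroup.cmDatum L 3 H').Local v ⧸ Subgroup.centralizer ({γ} : Set ((UnitaryGroup.cmDatum L 3 H').Local v)))]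
      (νHv : Measure ((UnitaryGroup.cmDatum L 2 (Matrix.of fun i j : Fin 2 => if i.val + j.val + 1 = 2 then (1 : L) else 0)).Local v × (UnitaryGroup.cmDatum L 1 (Matrix.of fun i j : Fin 1 => if i.val + j.val + 1 = 1 then (1 : L) else 0)).Local v)) (νGv : Measure ((UnitaryGroup.cmDatum L 3 H').Local v))
      [IsFiniteMeasureOnCompacts νHv] [νHv.IsMulRightInvariant] [νGv.IsHaarMeasure] [νGv.IsMulRightInvariant]
      (Δv : LocalTransferFactor L H' v)
      (mHv : OrbitalMeasureFamily ((UnitaryGroup.cmDatum L 2 (Matrix.of fun i j : Fin 2 => if i.val + j.val + 1 = 2 then (1 : L) else 0)).Local v × (UnitaryGroup.cmDatum L 1 (Matrix.of fun i j : Fin 1 => if i.val + j.val + 1 = 1 then (1 : L) else 0)).Local v)) (mGv : OrbitalMeasureFamily ((UnitaryGroup.cmDatum L 3 H').Local v)),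
      IsLocalTransferDatum L H' v Δv mHv mGv →
      mHv.IsCanonical (IsLocalGRegular L v) νHv →
      mGv.IsCanonical (fun γ : (UnitaryGroup.cmDatum L 3 H').Local v => IsRegularElt (γ.val : GL (Fin 3) (UnitaryGroup.LocalRing L v))) νGv →
      Subsingleton (UnitaryGroup.PlacesOver L v) →
    ∀ (μ : Literature.NumberTheory.GaloisRepresentations.HeckeCharacter L), μ.IsUnitary →
      (∀ x : Literature.NumberTheory.GaloisRepresentations.ideleGroup ↥(maximalRealSubfield L),
        μ (AdeleRing.ideleBaseChange (↥(maximalRealSubfield L)) L x) = quadraticHeckeCharCM L x) →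
      Δv = finExplicitCollection L H' μ (finExplicitDelta_conj_left_all L H' μ) (finExplicitDelta_conj_right_all L H' μ) v →
    ∀ (mGs₀v : OrbitalMeasureFamily ((UnitaryGroup.cmDatum L 3 H').Local v)),
      mGs₀v.IsQuotientOf (fun x : (UnitaryGroup.cmDatum L 3 H').Local v => ∃ γ₀ : (UnitaryGroup.cmDatum L 3 H').Rational, ¬ IsRegularElt (γ₀.val : GL (Fin 3) L) ∧
          Corresponds (UnitaryGroup.conjLocal L (IsCMField.complexConj L) v)
            ((UnitaryGroup.adelicForm L 3 H').map (UnitaryGroup.adeleToLocal L v))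
            ((UnitaryGroup.adelicForm L 3 H').map (UnitaryGroup.adeleToLocal L v))
            ((UnitaryGroup.cmDatum L 3 H').toLocal v ((UnitaryGroup.cmDatum L 3 H').toAdelic γ₀)) x) νGv (Literature.NumberTheory.Weil1982.UnitaryFinTopForm.finTamagawaPartner L 3 H' v) →
    ∀ (γ₀ : (UnitaryGroup.cmDatum L 3 H').Rational) (e₁ e₂ : L), e₁ ≠ e₂ →
      ((((γ₀ : unitaryGroup (cmConjRingHom L) H').val : GL (Fin 3) L) : Matrix (Fin 3) (Fin 3) L) - e₁ • (1 : Matrix (Fin 3) (Fin 3) L)) *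
        ((((γ₀ : unitaryGroup (cmConjRingHom L) H').val : GL (Fin 3) L) : Matrix (Fin 3) (Fin 3) L) - e₂ • (1 : Matrix (Fin 3) (Fin 3) L)) = 0 →
      (¬ ∃ ζ : L, (((γ₀ : unitaryGroup (cmConjRingHom L) H').val : GL (Fin 3) L) : Matrix (Fin 3) (Fin 3) L) = ζ • (1 : Matrix (Fin 3) (Fin 3) L)) →
      (((γ₀ : unitaryGroup (cmConjRingHom L) H').val : GL (Fin 3) L) : Matrix (Fin 3) (Fin 3) L).charpoly =
        (Polynomial.X - Polynomial.C e₁) ^ 2 * (Polynomial.X - Polynomial.C e₂) →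
    ∀ (γH : (UnitaryGroup.cmDatum L 2 (Matrix.of fun i j : Fin 2 => if i.val + j.val + 1 = 2 then (1 : L) else 0)).Rational × (UnitaryGroup.cmDatum L 1 (Matrix.of fun i j : Fin 1 => if i.val + j.val + 1 = 1 then (1 : L) else 0)).Rational),
      (((γH.1 : unitaryGroup (cmConjRingHom L) (Matrix.of fun i j : Fin 2 => if i.val + j.val + 1 = 2 then (1 : L) else 0)).val : GL (Fin 2) L) : Matrix (Fin 2) (Fin 2) L) =
        e₁ • (1 : Matrix (Fin 2) (Fin 2) L) →
      (((γH.2 : unitaryGroup (cmConjRingHom L) (Matrix.of fun i j : Fin 1 => if i.val + j.val + 1 = 1 then (1 : L) else 0)).val : GL (Fin 1) L) : Matrix (Fin 1) (Fin 1) L) 0 0 = e₂ →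
    ∃ c : ℝ, c ≠ 0 ∧ (c < 0 ↔ (∀ x : Fin 3 → UnitaryGroup.LocalRing L v,
            Matrix.mulVec (((((γ₀ : unitaryGroup (cmConjRingHom L) H').val : GL (Fin 3) L) : Matrix (Fin 3) (Fin 3) L)).map (algebraMap L (UnitaryGroup.LocalRing L v)) -
                algebraMap L (UnitaryGroup.LocalRing L v) e₁ • (1 : Matrix (Fin 3) (Fin 3) (UnitaryGroup.LocalRing L v))) x = 0 →
            (∑ i, ∑ j, UnitaryGroup.conjLocal L (IsCMField.complexConj L) v (x i) * algebraMap L (UnitaryGroup.LocalRing L v) (H' i j) * x j) = 0 →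
            x = 0)) ∧
      ∀ (fH : (UnitaryGroup.cmDatum L 2 (Matrix.of fun i j : Fin 2 => if i.val + j.val + 1 = 2 then (1 : L) else 0)).Local v × (UnitaryGroup.cmDatum L 1 (Matrix.of fun i j : Fin 1 => if i.val + j.val + 1 = 1 then (1 : L) else 0)).Local v → ℂ) (f : (UnitaryGroup.cmDatum L 3 H').Local v → ℂ),
        IsLocSmooth f → IsLocSmooth fH → IsLocalDeltaTransfer L H' v Δv mHv mGv fH f →
        Δv.Δ ((UnitaryGroup.cmDatum L 2 (Matrix.of fun i j : Fin 2 => if i.val + j.val + 1 = 2 then (1 : L) else 0)).toLocal v ((UnitaryGroup.cmDatum L 2 (Matrix.of fun i j : Fin 2 => if i.val + j.val + 1 = 2 then (1 : L) else 0)).toAdelic γH.1),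
            (UnitaryGroup.cmDatum L 1 (Matrix.of fun i j : Fin 1 => if i.val + j.val + 1 = 1 then (1 : L) else 0)).toLocal v ((UnitaryGroup.cmDatum L 1 (Matrix.of fun i j : Fin 1 => if i.val + j.val + 1 = 1 then (1 : L) else 0)).toAdelic γH.2)) ((UnitaryGroup.cmDatum L 3 H').toLocal v ((UnitaryGroup.cmDatum L 3 H').toAdelic γ₀)) *
            localStableOrbitalIntegral L 3 H' v mGs₀v f ((UnitaryGroup.cmDatum L 3 H').toLocal v ((UnitaryGroup.cmDatum L 3 H').toAdelic γ₀)) =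
          (c : ℂ) * fH ((UnitaryGroup.cmDatum L 2 (Matrix.of fun i j : Fin 2 => if i.val + j.val + 1 = 2 then (1 : L) else 0)).toLocal v ((UnitaryGroup.cmDatum L 2 (Matrix.of fun i j : Fin 2 => if i.val + j.val + 1 = 2 then (1 : L) else 0)).toAdelic γH.1),
            (UnitaryGroup.cmDatum L 1 (Matrix.of fun i j : Fin 1 => if i.val + j.val + 1 = 1 then (1 : L) else 0)).toLocal v ((UnitaryGroup.cmDatum L 1 (Matrix.of fun i j : Fin 1 => if i.val + j.val + 1 = 1 then (1 : L) else 0)).toAdelic γH.2)) := by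
  intro L _ _ _ H' hherm hanis v _ _ _ _ _ _ _ _ νHv νGv _ _ _ _ Δv mHv mGv hdat hcanH hcanG hns μ hμu hμω hΔv mGs₀v hquot
    γ₀ e₁ e₂ hne hprod hnsc hchar γH hγH1 hγH2
  obtain ⟨𝒢, C_H, hCH, hI, hEH⟩ := hII L H' hherm hanis v νHv νGv Δv mHv mGv hdat hcanH hcanG hns γH e₁ hγH1
  obtain ⟨C_G, hCG, hsgn, hEG⟩ :=
    hIII L H' hherm hanis v νHv νGv Δv mHv mGv hdat hcanH hcanG hns μ hμu hμω hΔv mGs₀v hquot γ₀ e₁ e₂ hne hprod hnsc hchar γH hγH1 hγH2 𝒢 C_H hI hEH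
  refine ⟨C_H / C_G, div_ne_zero hCH.ne hCG, (div_neg_iff_right_of_neg hCH).trans hsgn, ?_⟩
  intro fH f hf hfH htr
  obtain ⟨a, ha⟩ := hEH fH hfH
  obtain ⟨b, hb⟩ := hEG f hf
  have hev := eventually_nhdsWithin_of_forall
    (s := {γ : (UnitaryGroup.cmDatum L 2 (Matrix.of fun i j : Fin 2 => if i.val + j.val + 1 = 2 then (1 : L) else 0)).Local v × (UnitaryGroup.cmDatum L 1 (Matrix.of fun i j : Fin 1 => if i.val + j.val + 1 = 1 then (1 : L) else 0)).Local v |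
            IsLocalGRegular L v γ ∧ CompactSpace (Subgroup.centralizer ({γ} : Set ((UnitaryGroup.cmDatum L 2 (Matrix.of fun i j : Fin 2 => if i.val + j.val + 1 = 2 then (1 : L) else 0)).Local v × (UnitaryGroup.cmDatum L 1 (Matrix.of fun i j : Fin 1 => if i.val + j.val + 1 = 1 then (1 : L) else 0)).Local v)))})
    (a := ((UnitaryGroup.cmDatum L 2 (Matrix.of fun i j : Fin 2 => if i.val + j.val + 1 = 2 then (1 : L) else 0)).toLocal v ((UnitaryGroup.cmDatum L 2 (Matrix.of fun i j : Fin 2 => if i.val + j.val + 1 = 2 then (1 : L) else 0)).toAdelic γH.1),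
            (UnitaryGroup.cmDatum L 1 (Matrix.of fun i j : Fin 1 => if i.val + j.val + 1 = 1 then (1 : L) else 0)).toLocal v ((UnitaryGroup.cmDatum L 1 (Matrix.of fun i j : Fin 1 => if i.val + j.val + 1 = 1 then (1 : L) else 0)).toAdelic γH.2)))
    (fun γ hγ => (isLocalDeltaTransfer_iff L H' v Δv mHv mGv fH f).1 htr γ hγ.1)
  have key := constant_eq_of_eventually_expansions hI ha hb hev
  rw [Complex.ofReal_div]
  exact eq_div_mul_of_mul_eq (Complex.ofReal_ne_zero.2 hCG) key

end Summit.HodgeConjecture.HodgeConjecture.Cruxes.H413.K2E3SingularTransferSignedLocalOfEllipticGerms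

end
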